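import Summits.SmoothPoincare4.SmoothPoincare4.Theorems.CongruenceShadowsGriffithsHandlebodyExtensionCoverPlanarG
import Summits.SmoothPoincare4.SmoothPoincare4.Theorems.CongruenceShadowsGriffithsHandlebodyExtensionCoverAssembly
import HarnessLib

/-!
# SmoothPoincare4 / CongruenceShadows — `GriffithsHandlebodyExtension` (item stmt-SmoothPoincare4-15190): the planar family (E3), C.4 — the global family; (E)

Support file (`--supports` stmt-SmoothPoincare4-15190) of the homothety-cover proof of the genus-one
clause (E) of Griffiths' handlebody extension theorem — *every self-diffeomorphism of the Heegaard torus
`∂V` of the round solid torus fixing the base point and acting trivially on `π₁(∂V)` extends to a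
self-diffeomorphism of `V`* (hypothesis `hE` of
`Literature.Topology.FourManifolds.RoundSolidTorusModel.diffeoExtends_of_map_ker_eq_ker_of_forall_diffeoExtends`).
See the module docstring of `…CoverDefs` for the whole line (E1–E6) and the notation
(`τ̂`, `δ_λ`, `ρ`, `χ`, `f`, `Δ^(c)`, `α`, `L`, `M`, `Ψ̂`, `ẽ_c`).

This part (E3-C, last third, ii, and the conclusion): the global family `ẽ_c = E_{frac c}` (locally a single branch,
hence smooth; fibrewise inverse smooth by the inverse function theorem; log-periodic; correct boundary values and
image), `Planar.PI.hasFamily` (E3), and finally `HomothetyCover.forall_diffeoExtends`: **(E) holds unconditionally**.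
-/

-- the registered namespace `Summit.SmoothPoincare4.SmoothPoincare4.Theorems` repeats a component
set_option linter.dupNamespace false

noncomputable section

namespace Summit.SmoothPoincare4.SmoothPoincare4.Theorems

namespace HomothetyCover

open Set Function Metric Filter
open scoped Topology ContDiff

namespace Planar

open Set Function Metric Filter
open scoped Topology ContDiff Manifold
open Literature.Topology.FourManifolds
attribute [local instance] factFinrankE2
variable {lam : ℝ} (P : PI lam)

section Global

variable {lam : ℝ} {P : PI lam} {D : PI.CD P}

namespace PI

namespace CD.KD

variable (Q : D.KD)

/-- **The global family** `ẽ_c = E_{frac c}`. -/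
def e (c : ℝ) (z : E2) : E2 := Q.Ebr (frac lam c) z

/-- Its fibrewise inverse (as a left inverse via choice; smoothness at image points is proved by
the inverse function theorem). -/
def e' (c : ℝ) : E2 → E2 := Function.invFun (Q.e c)

/-- `ẽ'_c ∘ ẽ_c = id`. -/
theorem e'_e (c : ℝ) (z : E2) : Q.e' c (Q.e c z) = z :=
  Function.leftInverse_invFun (Q.Ebr_injective _) z

/-- Local single-branch description of `ẽ`. -/
theorem e_eq_Ebr (hlam : 1 < lam) {c₀ c : ℝ} (h : |tOf lam c - tOf lam c₀| < 1 / 8)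
    {z : E2} (hz : ‖z‖ < 1 + D.η / 2) : Q.e c z = Q.Ebr (tOf lam c - mOf lam c₀) z := by
  have h1 := Int.floor_le (tOf lam c + 1 / 8)
  have h2 := Int.lt_floor_add_one (tOf lam c + 1 / 8)
  have h3 := Int.floor_le (tOf lam c₀ + 1 / 8)
  have h4 := Int.lt_floor_add_one (tOf lam c₀ + 1 / 8)
  rw [abs_lt] at h
  set m : ℤ := mOf lam c with hm
  set m₀ : ℤ := mOf lam c₀ with hm₀
  have hm' : (⌊tOf lam c + 1 / 8⌋ : ℤ) = m := rfl
  have hm₀' : (⌊tOf lam c₀ + 1 / 8⌋ : ℤ) = m₀ := rfl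
  rw [hm'] at h1 h2; rw [hm₀'] at h3 h4
  have hup : (m : ℝ) < m₀ + 2 := by linarith
  have hlo : (m₀ : ℝ) < m + 2 := by linarith
  have hup' : m < m₀ + 2 := by exact_mod_cast hup
  have hlo' : m₀ < m + 2 := by exact_mod_cast hlo
  have hcases : m = m₀ ∨ m = m₀ + 1 ∨ m = m₀ - 1 := by omega
  unfold e frac
  rw [← hm]
  rcases hcases with h0 | h0 | h0
  · rw [h0]
  · rw [h0]; push_cast
    have hlo1 : ((m₀ + 1 : ℤ) : ℝ) ≤ tOf lam c + 1 / 8 := by rw [← h0]; exact h1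
    push_cast at hlo1
    have key := Q.Ebr_add_one hlam (t := tOf lam c - m₀ - 1) ⟨by linarith, by linarith⟩ hz
    rw [show tOf lam c - (m₀ : ℝ) - 1 + 1 = tOf lam c - m₀ by ring] at key
    rw [show tOf lam c - ((m₀ : ℝ) + 1) = tOf lam c - m₀ - 1 by ring]
    exact key.symm
  · rw [h0]; push_cast
    rw [show tOf lam c - (m₀ - 1 : ℝ) = (tOf lam c - m₀) + 1 by ring]
    refine Q.Ebr_add_one hlam ⟨?_, ?_⟩ hz
    · linarith
    · have : tOf lam c + 1 / 8 < ((m₀ - 1 : ℤ) : ℝ) + 1 := by rw [← h0]; exact h2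
      push_cast at this; linarith

/-- The neighbourhood on which the single-branch description holds. -/
theorem eventually_branch {c₀ : ℝ} (hc₀ : 0 < c₀) {z₀ : E2} (hz₀ : ‖z₀‖ < 1 + D.η / 2) :
    ∀ᶠ q : ℝ × E2 in 𝓝 (c₀, z₀), 0 < q.1 ∧ |tOf lam q.1 - tOf lam c₀| < 1 / 8 ∧ ‖q.2‖ < 1 + D.η / 2 := by
  have h1 : ∀ᶠ q : ℝ × E2 in 𝓝 (c₀, z₀), 0 < q.1 :=
    (isOpen_lt continuous_const continuous_fst).mem_nhds hc₀
  have hcont : ContinuousAt (tOf lam ∘ Prod.fst) ((c₀, z₀) : ℝ × E2) :=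
    (contDiffAt_tOf hc₀).continuousAt.comp continuousAt_fst
  have h2 : ∀ᶠ q : ℝ × E2 in 𝓝 (c₀, z₀), |tOf lam q.1 - tOf lam c₀| < 1 / 8 := by
    have := hcont.preimage_mem_nhds (Metric.ball_mem_nhds (tOf lam c₀) (by norm_num : (0 : ℝ) < 1 / 8))
    filter_upwards [this] with q hq
    have hq' : dist (tOf lam q.1) (tOf lam c₀) < 1 / 8 := hq
    rwa [Real.dist_eq] at hq'
  have h3 : ∀ᶠ q : ℝ × E2 in 𝓝 (c₀, z₀), ‖q.2‖ < 1 + D.η / 2 :=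
    (isOpen_lt (continuous_norm.comp continuous_snd) continuous_const).mem_nhds hz₀
  filter_upwards [h1, h2, h3] with q a b c using ⟨a, b, c⟩

/-- `(c, z) ↦ (t(c) - m₀, z)` is smooth at `c > 0`. -/
theorem contDiffAt_shift (m₀ : ℤ) {c₀ : ℝ} (hc₀ : 0 < c₀) (z₀ : E2) :
    ContDiffAt ℝ ∞ (fun q : ℝ × E2 => (tOf lam q.1 - (m₀ : ℝ), q.2)) (c₀, z₀) := by
  have h1 : ContDiffAt ℝ ∞ (fun c : ℝ => tOf lam c - (m₀ : ℝ)) c₀ :=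
    (contDiffAt_tOf hc₀).sub contDiffAt_const
  have h2 : ContDiffAt ℝ ∞ ((fun c : ℝ => tOf lam c - (m₀ : ℝ)) ∘ Prod.fst) ((c₀, z₀) : ℝ × E2) :=
    h1.comp (c₀, z₀) contDiffAt_fst
  exact h2.prodMk contDiffAt_snd

/-- `(c, z) ↦ E_{t(c) - m₀} z` is smooth at `c > 0`. -/
theorem contDiffAt_Ebr_shift (m₀ : ℤ) {c₀ : ℝ} (hc₀ : 0 < c₀) (z₀ : E2) :
    ContDiffAt ℝ ∞ (fun q : ℝ × E2 => Q.Ebr (tOf lam q.1 - m₀) q.2) (c₀, z₀) := by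
  have h3 : ContDiffAt ℝ ∞ (uncurry Q.Ebr ∘ fun q : ℝ × E2 => (tOf lam q.1 - (m₀ : ℝ), q.2)) (c₀, z₀) :=
    Q.contDiff_Ebr.contDiffAt.comp (c₀, z₀) (contDiffAt_shift m₀ hc₀ z₀)
  exact h3

/-- `(c, z) ↦ ẽ_c z` is smooth at `c > 0`, `‖z‖ < 1 + η/2` (locally a single branch). -/
theorem contDiffAt_e (hlam : 1 < lam) {c₀ : ℝ} (hc₀ : 0 < c₀) {z₀ : E2} (hz₀ : ‖z₀‖ < 1 + D.η / 2) :
    ContDiffAt ℝ ∞ (uncurry Q.e) (c₀, z₀) := by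
  have heq : (uncurry Q.e) =ᶠ[𝓝 (c₀, z₀)] fun q => Q.Ebr (tOf lam q.1 - mOf lam c₀) q.2 := by
    filter_upwards [eventually_branch (D := D) hc₀ hz₀] with q hq
    exact Q.e_eq_Ebr hlam hq.2.1 hq.2.2
  exact (Q.contDiffAt_Ebr_shift (mOf lam c₀) hc₀ z₀).congr_of_eventuallyEq heq

/-- Smoothness of the inverse family at image points, by the inverse function theorem applied to
`(c, z) ↦ (c, ẽ_c z)`. -/
theorem contDiffAt_e' (hlam : 1 < lam) {c₀ : ℝ} (hc₀ : 0 < c₀) {z₀ : E2} (hz₀ : ‖z₀‖ < 1 + D.η / 2) :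
    ContDiffAt ℝ ∞ (uncurry Q.e') (c₀, Q.e c₀ z₀) := by
  -- the map and its local smooth left inverse
  set F : ℝ × E2 → ℝ × E2 := fun q => (q.1, Q.e q.1 q.2) with hF
  set G : ℝ × E2 → ℝ × E2 := fun q => (q.1, Q.Ebr' (tOf lam q.1 - mOf lam c₀) q.2) with hG
  have hFs : ContDiffAt ℝ ∞ F (c₀, z₀) := contDiffAt_fst.prodMk (Q.contDiffAt_e hlam hc₀ hz₀)
  have hF0 : F (c₀, z₀) = (c₀, Q.Ebr (tOf lam c₀ - mOf lam c₀) z₀) := rfl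
  have hGs : ContDiffAt ℝ ∞ G (F (c₀, z₀)) := by
    rw [hF0]
    refine contDiffAt_fst.prodMk ?_
    have h3 := (Q.contDiffAt_Ebr' (tOf lam c₀ - mOf lam c₀) z₀).comp_contDiffWithinAt_of_eq
      ((c₀, Q.Ebr (tOf lam c₀ - mOf lam c₀) z₀) : ℝ × E2)
      ((contDiffAt_shift (lam := lam) (mOf lam c₀) hc₀
        (Q.Ebr (tOf lam c₀ - mOf lam c₀) z₀)).contDiffWithinAt (s := Set.univ)) rfl
    rw [contDiffWithinAt_univ] at h3
    exact h3
  have hGF : ∀ᶠ q in 𝓝 (c₀, z₀), G (F q) = q := by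
    filter_upwards [eventually_branch (D := D) hc₀ hz₀] with q hq
    show (q.1, Q.Ebr' (tOf lam q.1 - mOf lam c₀) (Q.e q.1 q.2)) = q
    rw [Q.e_eq_Ebr hlam hq.2.1 hq.2.2, Q.Ebr'_Ebr]
  -- the derivative of `F` is invertible
  have hn : (∞ : WithTop ℕ∞) ≠ 0 := by simp
  set F' := fderiv ℝ F (c₀, z₀) with hF'
  set G' := fderiv ℝ G (F (c₀, z₀)) with hG'
  have hFd : HasFDerivAt F F' (c₀, z₀) := (hFs.differentiableAt hn).hasFDerivAt
  have hGd : HasFDerivAt G G' (F (c₀, z₀)) := (hGs.differentiableAt hn).hasFDerivAt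
  have hcomp : HasFDerivAt (G ∘ F) (G'.comp F') (c₀, z₀) := hGd.comp _ hFd
  have hid : HasFDerivAt (G ∘ F) (ContinuousLinearMap.id ℝ (ℝ × E2)) (c₀, z₀) :=
    (hasFDerivAt_id (c₀, z₀)).congr_of_eventuallyEq (hGF.mono fun q hq => hq)
  have hGF' : G'.comp F' = ContinuousLinearMap.id ℝ (ℝ × E2) := hcomp.unique hid
  have hinj : Function.Injective F' := by
    intro a b hab
    have := congrArg G' hab
    rw [← ContinuousLinearMap.comp_apply, ← ContinuousLinearMap.comp_apply, hGF'] at this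
    simpa using this
  have hsurj : Function.Surjective F' :=
    (LinearMap.injective_iff_surjective (f := (F' : (ℝ × E2) →ₗ[ℝ] (ℝ × E2)))).1 hinj
  let Feq : (ℝ × E2) ≃L[ℝ] (ℝ × E2) :=
    (LinearEquiv.ofBijective (F' : (ℝ × E2) →ₗ[ℝ] (ℝ × E2)) ⟨hinj, hsurj⟩).toContinuousLinearEquiv
  have hFeq : (Feq : (ℝ × E2) →L[ℝ] (ℝ × E2)) = F' := ContinuousLinearMap.ext fun v => rfl
  have hderiv : HasFDerivAt F (Feq : (ℝ × E2) →L[ℝ] (ℝ × E2)) (c₀, z₀) := by rw [hFeq]; exact hFd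
  -- inverse function theorem and uniqueness of the local inverse
  have hinv := hFs.to_localInverse hderiv hn
  set Ginv : ℝ × E2 → ℝ × E2 := fun q => (q.1, Q.e' q.1 q.2) with hGinv
  have hagree : ∀ᶠ y in 𝓝 (F (c₀, z₀)), Ginv y = hFs.localInverse hderiv hn y := by
    apply (hFs.hasStrictFDerivAt' hderiv hn).localInverse_unique
    exact Filter.Eventually.of_forall fun q => by simp [hGinv, hF, Q.e'_e]
  have hGinvs : ContDiffAt ℝ ∞ Ginv (F (c₀, z₀)) := hinv.congr_of_eventuallyEq hagree
  have : uncurry Q.e' = Prod.snd ∘ Ginv := by funext q; rfl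
  rw [this]
  exact contDiffAt_snd.comp _ hGinvs

/-- **Log-periodicity** `ẽ_{λc} = ẽ_c`. -/
theorem e_per (hlam : 1 < lam) {c : ℝ} (hc : 0 < c) (z : E2) : Q.e (lam * c) z = Q.e c z := by
  rw [e, e, frac_mul hlam hc]

/-- On the unit circle `ẽ_c = δ_c⁻¹ ∘ τ ∘ δ_c`. -/
theorem e_sphere (hlam : 1 < lam) {c : ℝ} (hc : 0 < c) {u : E2} (hu : ‖u‖ = 1) :
    Q.e c u = c⁻¹ • P.τ (c • u) := by
  have hl : 0 < lam := lt_trans zero_lt_one hlam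
  have hf := frac_mem (lam := lam) c
  rw [e, Q.Ebr_sphere ⟨by linarith [hf.1], by linarith [hf.2]⟩ hu, frac]
  have := P.S_add_int hl (mOf lam c) (tOf lam c - mOf lam c) u
  rw [sub_add_cancel] at this
  rw [← this, PI.S, cexp_tOf hlam hc]

/-- `ẽ_c` maps the closed unit disc onto `{w | w = 0 ∨ ‖τ' (c w)‖ ≤ c} = δ_c⁻¹ τ (c D̄)`. -/
theorem e_image (hlam : 1 < lam) {c : ℝ} (hc : 0 < c) :
    Q.e c '' closedBall (0 : E2) 1 = {w | w = 0 ∨ ‖P.τ' (c • w)‖ ≤ c} := by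
  have hl : 0 < lam := lt_trans zero_lt_one hlam
  have hf := frac_mem (lam := lam) c
  have himg := Q.Ebr_image_closedBall hlam (t := frac lam c) ⟨by linarith [hf.1], by linarith [hf.2]⟩
  have he : Q.e c = Q.Ebr (frac lam c) := rfl
  rw [he, himg]
  ext w
  simp only [mem_setOf_eq]
  rw [← P.norm_S'_le_one_iff, frac, show tOf lam c - (mOf lam c : ℝ) = tOf lam c + ((-mOf lam c : ℤ) : ℝ) by
    push_cast; ring, P.S'_add_int hl, P.norm_S'_le_one_iff, cexp_tOf hlam hc]
  constructor
  · intro h; exact Or.inr h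
  · rintro (rfl | h)
    · rw [smul_zero, P.τ'_zero, norm_zero]; exact hc.le
    · exact h

end CD.KD

/-- **Part C, conclusion (E3 for the planar input)**: the log-periodic family of smooth embeddings
of a neighbourhood of the closed unit disc. -/
theorem hasFamily (hlam : 1 < lam) : ∃ (R₁ : ℝ) (e e' : ℝ → E2 → E2), 1 < R₁ ∧
    (∀ c, 0 < c → ∀ u : E2, ‖u‖ < R₁ → ContDiffAt ℝ ∞ (uncurry e) (c, u)) ∧
    (∀ c, 0 < c → ∀ u : E2, ‖u‖ < R₁ → e' c (e c u) = u) ∧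
    (∀ c, 0 < c → ∀ u : E2, ‖u‖ < R₁ → ContDiffAt ℝ ∞ (uncurry e') (c, e c u)) ∧
    (∀ c, 0 < c → ∀ u : E2, ‖u‖ < R₁ → e (lam * c) u = e c u) ∧
    (∀ c, 0 < c → ∀ u : E2, ‖u‖ = 1 → e c u = c⁻¹ • P.τ (c • u)) ∧
    (∀ c, 0 < c → e c '' closedBall (0 : E2) 1 = {w | w = 0 ∨ ‖P.τ' (c • w)‖ ≤ c}) := by
  obtain ⟨D⟩ := P.nonempty_CD hlam
  obtain ⟨Q⟩ := D.nonempty_KD hlam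
  exact ⟨1 + D.η / 2, Q.e, Q.e', by linarith [D.η_pos],
    fun c hc u hu => Q.contDiffAt_e hlam hc hu,
    fun c _ u _ => Q.e'_e c u,
    fun c hc u hu => Q.contDiffAt_e' hlam hc hu,
    fun c hc u _ => Q.e_per hlam hc u,
    fun c hc u hu => Q.e_sphere hlam hc hu,
    fun c hc => Q.e_image hlam hc⟩

end PI

end Global

end Planar

section Final

open Literature.Topology.FourManifolds Literature.Topology.FourManifolds.RoundSolidTorusModel
open scoped Manifold

/-- A planar input viewed as the planar development's `Planar.PI`. -/
def PlanarInput.toPI {lam : ℝ} (P : PlanarInput lam) : Planar.PI lam where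
  τ := P.τ
  τ' := P.τ'
  τ_zero := P.τ_zero
  τ'_zero := P.τ'_zero
  contDiffAt_τ := P.contDiffAt_τ
  contDiffAt_τ' := P.contDiffAt_τ'
  τ'_τ := P.τ'_τ
  τ_τ' := P.τ_τ'
  τ_smul := P.τ_smul

/-- **(E3)**: every planar input admits a log-periodic planar family. -/
theorem PlanarInput.hasFamily {lam : ℝ} (hlam : 1 < lam) (P : PlanarInput lam) : P.HasFamily :=
  Planar.PI.hasFamily (P := P.toPI) hlam

/-- **(E), unconditionally**: every self-diffeomorphism of `∂V` fixing `basePt` and acting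
trivially on `π₁(∂V, basePt)` extends to a diffeomorphism of the round solid torus `V` —
hypothesis `hE` of `RoundSolidTorusModel.diffeoExtends_of_map_ker_eq_ker_of_forall_diffeoExtends`. -/
theorem forall_diffeoExtends
    (τV : (𝓡∂ 3).boundary RoundSolidTorus ≃ₘ⟮𝓡 2, 𝓡 2⟯ (𝓡∂ 3).boundary RoundSolidTorus)
    (hτ : τV basePt = basePt)
    (h : ∀ γ, FundamentalGroup.mapOfEq (⟨τV, τV.continuous⟩ : C(_, _)) hτ γ = γ) :
    (BoundaryManifold.boundaryData 2 RoundSolidTorus).DiffeoExtends τV :=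
  forall_diffeoExtends_of_hasFamily 2 one_lt_two (fun P => P.hasFamily one_lt_two) τV hτ h

end Final

end HomothetyCover

end Summit.SmoothPoincare4.SmoothPoincare4.Theorems

end
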